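import Summits.BirchSwinnertonDyer.BirchSwinnertonDyer.Theorems.ResidualThetaTransportAtTwoResidualSignedLambdaLowerCMAtTwoPairingSumPlusValue
import Summits.BirchSwinnertonDyer.BirchSwinnertonDyer.Theorems.ResidualThetaTransportAtTwoResidualSignedLambdaLowerCMAtTwoColemanPlusOntoTwo
import Summits.BirchSwinnertonDyer.Rank1Residual.Supersingular.SprungPollackConsistency
import HarnessLib

/-!
# Sprung's Coleman PAIR exists at `a_p = 0` for EVERY prime `p` (in particular `p = 2`) and trace-compatible families, and the
# ♭ = plus Coleman map `Col♭ : H¹_Iw → Λ` is ONTO (in the limit, all levels at once) as soon as one functional is a unit at `c_0` —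
# Kobayashi's Theorem 6.2 (6.13) `Col⁺ : H¹_Iw/H¹_{Iw,+} ≅ Λ` at the prime `2` for the cyclotomic `ℤ₂`-tower

Route `ResidualThetaTransportAtTwo` (RTT), crux RSL_g `ResidualSignedLambdaLowerCMAtTwo` (stmt-BirchSwinnertonDyer-22608; node N1 «local⁺ at 2» of
`Cruxes/ResidualThetaCountLowerPureAtTwo/RSLG-LINE-DAG-g14.md`). Seat `prover-bsd-wall-rtt-p2` g14 (`--supports`, closes nothing). Sequel of p654585,
p655125, p655473, p655747. HONEST FRAMING: THEOREMS ONLY (no definition, no named fact, no instance, no `sorry`); statements about Sprung's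
`IsColemanPair` predicate (`Sprung2012/ColemanMaps.lean`, functional model of `H¹_Iw`) for an abstract family of local points `c` with
(L) `c n ∈ E(K_n·K_v)` and (TR) `Tr_{n+2/n+1} c_{n+2} = −c_n` (`a_p = 0` shape; at `p = 2` on the `ℤ₂`-tower: HONDA⁺@2); nothing about any
Selmer group or `L`-function; BSD is not proved by any of this.

## What
* §1 (abstract, `ℤ_p`): odd-level compatibility `X·ω⁻_{2m+1} ∣ u'_{m+1} + u'_m` for `Q_{2m+1} = ω⁺_{2m+1}·u'_m` and the MINUS value
  `∃ L', ∀ m, ω_{2m+1} ∣ Q_{2m+1} − (−1)^m ω⁺_{2m+1} L'` (`exists_minusValue_orbitSum`; gluing along `X ω⁻_{2m+1} = X Φ_p(X+1) ∏_{i<m}Φ_{p^{2i+3}}(X+1)`).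
* §2 **`exists_isColemanPair_apZero`** — for `c` with (L), (TR) on a `ℤ_p`-tower `κ` (any `K`, `p`, `ι`), a local lift `g` of the topological
  generator and EVERY functional `z` on `E(K_∞·K_v)`: `∃ L♯ L♭, IsColemanPair κ ι W 0 g c z L♯ L♭` (Sprung Prop. 3.9 / 5.3 / Def. 5.9 at
  `a_p = 0`, from the plus and minus values: `u_{2k} = 0`, `u_{2k+1} = (−1)^k ω⁺_{2k+1}`, `v_{2k} = (−1)^k ω⁻_{2k}`, `v_{2k+1} = 0`,
  tree `Rank1Residual.Supersingular.sharpPoly_zero_even_and_odd` / `flatPoly_zero_even_and_odd`).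
* §3 **`exists_isColemanPair_flat_eq_of_isUnit`** — if SOME functional `z₀` takes a unit value at `c_0`, then for EVERY `a ∈ Λ` there is a
  functional `z` and `L♯` with `IsColemanPair κ ι W 0 g c z L♯ a`: the ♭-Coleman map is ONTO `Λ` (Kobayashi Thm. 6.2 (6.13) / Sprung Prop. 7.3
  at `a_p = 0`, ANY `p`): the ♭ value of `z₀` is a unit (`…PairingSumOnto.isUnit_quotient_iff` + the value congruence), then the tree's
  `Λ`-linearity `Sprung2012.IsColemanPair.exists_mul`.
* §4 **`colemanFlat_onto_two`** — `p = 2`, `W/ℚ` globally minimal, `GoodSS W 2`, `a₂(W) = 0`, cyclotomic `κ`, `v ∋ 2`: with the HONDA⁺@2 family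
  `d` ((L),(TR),(ND), `…ColemanPlusOntoTwo.exists_plusHonda_nonDiv_two`) and a local generator `g`, EVERY `a ∈ Λ = ℤ₂⟦T⟧` is the ♭ (= plus) Coleman
  value of some functional on `E(ℚ_{2,∞}·ℚ_v)`. This is the surjectivity half of `Col⁺ : H¹_Iw(T)/H¹_{Iw,+} ≅ Λ` at `p = 2` (the kernel half is
  the tree's `…LocalTwoPlusColemanKernel` / `…FlatEqualsPlus`), i.e. `coker Col⁺ = 0` — the decisive local input of RSL_g (CSCAN-SIGNED-AT-TWO-g14).

References: [Kobayashi2003] Thm. 6.2, Prop. 8.19–8.23 (pp. 11, 20–22); [Sprung2012] Prop. 3.9, Prop. 5.3, Def. 5.9, Prop. 7.3 (pp. 1491–1500);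
[Sprung2017] Cor. 4.4 (`u_n`, `v_n` at `a_p = 0`); [Lang1990] Ch. 5 §1 Thm. 1.1.
-/

set_option autoImplicit false
-- the Theorems namespace of this sub repeats the summit name by design (D-0017 nested layout)
set_option linter.dupNamespace false

noncomputable section

open scoped Classical
open Polynomial Finset

namespace Summit.BirchSwinnertonDyer.BirchSwinnertonDyer.Theorems.SignedColemanImage

open Literature.NumberTheory.EllipticCurves Literature.NumberTheory.EllipticCurves.Sprung2017
  Literature.NumberTheory.EllipticCurves.Kobayashi2003 Summit.BirchSwinnertonDyer.Rank1Residual.Supersingular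

/-! ## §1 Odd levels: compatibility and the minus value -/

section Abstract

variable {p : ℕ} [Fact p.Prime]

/-- `ω_{2m+2} = X·ω⁻_{2m+1}·ω⁺_{2m+3}` (`ω⁺_{2m+2} = ω⁺_{2m+3}`, `ω⁻_{2m+2} = ω⁻_{2m+1}`). [cite: Pollack2003, §6.5 (display before Prop. 6.18)] -/
theorem cyclotomicOmega_two_mul_add_two_eq (m : ℕ) :
    cyclotomicOmega p (2 * m + 2) = X * cyclotomicOmegaMinus p (2 * m + 1) * cyclotomicOmegaPlus p (2 * m + 3) := by
  rw [← X_mul_cyclotomicOmegaPlus_mul_cyclotomicOmegaMinus, ← cyclotomicOmegaMinus_two_mul_add_one,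
    show 2 * m + 3 = 2 * (m + 1) + 1 by ring, cyclotomicOmegaPlus_two_mul_add_one, show 2 * (m + 1) = 2 * m + 2 by ring]
  ring

omit [Fact p.Prime] in
/-- `ω⁺_{2m+3} = ω⁺_{2m+1}·Φ_{p^{2m+2}}(X+1)`. [cite: Pollack2003, §6.5 (display before Prop. 6.18)] -/
theorem cyclotomicOmegaPlus_two_mul_add_three (m : ℕ) :
    cyclotomicOmegaPlus p (2 * m + 3) = cyclotomicOmegaPlus p (2 * m + 1) * (cyclotomic (p ^ (2 * m + 2)) ℤ).comp (X + 1) := by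
  rw [show 2 * m + 3 = 2 * (m + 1) + 1 by ring, cyclotomicOmegaPlus_two_mul_add_one, show 2 * (m + 1) = 2 * m + 2 by ring,
    cyclotomicOmegaPlus_two_mul_add_two, cyclotomicOmegaPlus_two_mul_add_one]

/-- **Odd compatibility**: for orbit polynomials of a trace-compatible coefficient family, the quotients `u'_m := Q_{2m+1}/ω⁺_{2m+1}` satisfy
`X·ω⁻_{2m+1} ∣ u'_{m+1} + u'_m`. [cite: Kobayashi2003, Prop. 8.21 (8.26) (p. 21)] -/
theorem X_mul_cyclotomicOmegaMinus_dvd_add (a : ℕ → ℕ → ℤ_[p])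
    (hper : ∀ n t, a n (t + p ^ n) = a n t)
    (htr : ∀ n r, ∑ s ∈ range p, a (n + 2) (r + p ^ (n + 1) * s) = -a n r) (m : ℕ) (u u' : ℤ_[p][X])
    (hu : ∑ j ∈ range (p ^ (2 * m + 1)), C (a (2 * m + 1) j) * (X + 1) ^ j =
      (cyclotomicOmegaPlus p (2 * m + 1)).map (Int.castRingHom ℤ_[p]) * u)
    (hu' : ∑ j ∈ range (p ^ (2 * m + 3)), C (a (2 * m + 3) j) * (X + 1) ^ j =
      (cyclotomicOmegaPlus p (2 * m + 3)).map (Int.castRingHom ℤ_[p]) * u') :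
    (X * cyclotomicOmegaMinus p (2 * m + 1)).map (Int.castRingHom ℤ_[p]) ∣ u' + u := by
  have hp : p.Prime := Fact.out
  have h3 := cyclotomicOmega_dvd_orbitSum_add hp (2 * m + 1) (a (2 * m + 3)) (a (2 * m + 1)) (hper (2 * m + 1)) (htr (2 * m + 1))
  rw [show 2 * m + 1 + 2 = 2 * m + 3 by ring, show 2 * m + 1 + 1 = 2 * m + 2 by ring, hu', hu] at h3
  have h4 : (cyclotomicOmega p (2 * m + 2)).map (Int.castRingHom ℤ_[p]) ∣
      (cyclotomicOmegaPlus p (2 * m + 3)).map (Int.castRingHom ℤ_[p]) * (u' + u) := by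
    have e : (cyclotomicOmegaPlus p (2 * m + 3)).map (Int.castRingHom ℤ_[p]) * (u' + u) =
        (cyclotomicOmegaPlus p (2 * m + 3)).map (Int.castRingHom ℤ_[p]) * u' +
          ((cyclotomic (p ^ (2 * m + 2)) ℤ).comp (X + 1)).map (Int.castRingHom ℤ_[p]) *
            ((cyclotomicOmegaPlus p (2 * m + 1)).map (Int.castRingHom ℤ_[p]) * u) := by
      rw [mul_add, cyclotomicOmegaPlus_two_mul_add_three, Polynomial.map_mul]; ring
    rw [e]; exact h3
  rw [cyclotomicOmega_two_mul_add_two_eq, Polynomial.map_mul, mul_comm] at h4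
  have hne : (cyclotomicOmegaPlus p (2 * m + 3)).map (Int.castRingHom ℤ_[p]) ≠ 0 :=
    ((monic_cyclotomicOmegaPlus p (2 * m + 3)).map _).ne_zero
  exact (mul_dvd_mul_iff_left hne).mp h4

/-- **The minus value of an orbit family exists** (abstract form over `ℤ_p`): `∃ L', ∀ m, ω_{2m+1} ∣ Q_{2m+1}(a_{2m+1}) − (−1)^m·ω⁺_{2m+1}·L'`.
[cite: Kobayashi2003, Cor. 8.20, Prop. 8.21 and Def. 8.22 (pp. 21–22)] [cite: Lang1990, Ch. 5 §1 Thm. 1.1] -/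
theorem exists_minusValue_orbitSum (a : ℕ → ℕ → ℤ_[p])
    (hper : ∀ n t, a n (t + p ^ n) = a n t)
    (htr : ∀ n r, ∑ s ∈ range p, a (n + 2) (r + p ^ (n + 1) * s) = -a n r) :
    ∃ L : PowerSeries ℤ_[p], ∀ m : ℕ,
      (((cyclotomicOmega p (2 * m + 1)).map (Int.castRingHom ℤ_[p]) : ℤ_[p][X]) : PowerSeries ℤ_[p]) ∣
        ((∑ j ∈ range (p ^ (2 * m + 1)), C (a (2 * m + 1) j) * (X + 1) ^ j : ℤ_[p][X]) : PowerSeries ℤ_[p]) -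
          (-1 : PowerSeries ℤ_[p]) ^ m * ((((cyclotomicOmegaPlus p (2 * m + 1)).map (Int.castRingHom ℤ_[p]) : ℤ_[p][X]) :
            PowerSeries ℤ_[p]) * L) := by
  choose u hu using fun m ↦ cyclotomicOmegaPlus_dvd_orbitSum (R := ℤ_[p]) a hper htr m
  choose t ht using fun m ↦ X_mul_cyclotomicOmegaMinus_dvd_add a hper htr m (u m) (u (m + 1)) (hu m)
    (by rw [show 2 * m + 3 = 2 * (m + 1) + 1 by ring]; exact hu (m + 1))
  set B : ℤ_[p][X] := (X * (cyclotomic p ℤ).comp (X + 1)).map (Int.castRingHom ℤ_[p]) with hB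
  set ξ : ℕ → ℤ_[p][X] := fun i ↦ ((cyclotomic (p ^ (2 * i + 3)) ℤ).comp (X + 1)).map (Int.castRingHom ℤ_[p]) with hξ
  have hξp : ∀ i, (p : ℤ_[p]) ∣ (ξ i).coeff 0 := fun i ↦ by
    show (p : ℤ_[p]) ∣ (((cyclotomic (p ^ (2 * i + 3)) ℤ).comp (X + 1)).map (Int.castRingHom ℤ_[p])).coeff 0
    rw [show 2 * i + 3 = (2 * i + 2) + 1 by ring]
    exact prime_dvd_coeff_zero_cyclotomic_comp (2 * i + 2)
  have hprod : ∀ M, B * ∏ i ∈ range M, ξ i = (X * cyclotomicOmegaMinus p (2 * M + 1)).map (Int.castRingHom ℤ_[p]) := by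
    intro M
    rw [hB, cyclotomicOmegaMinus_two_mul_add_one_eq_prod, Polynomial.map_mul, Polynomial.map_mul, Polynomial.map_mul,
      Polynomial.map_prod, mul_assoc]
  set g : ℕ → ℤ_[p][X] := fun M ↦ C ((-1 : ℤ_[p]) ^ M) * u M with hg
  have hgstep : ∀ M, g (M + 1) - g M = B * (∏ i ∈ range M, ξ i) * (C ((-1 : ℤ_[p]) ^ (M + 1)) * t M) := by
    intro M
    rw [hprod M, mul_left_comm, ← ht M, hg]
    simp only [pow_succ, map_mul, map_neg, map_one]
    ring
  obtain ⟨L, hL⟩ := exists_powerSeries_sub_eq_mul B ξ hξp g (fun M ↦ C ((-1 : ℤ_[p]) ^ (M + 1)) * t M) hgstep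
  refine ⟨L, fun m ↦ ?_⟩
  obtain ⟨Q, hQ⟩ := hL m
  rw [hprod m] at hQ
  have hgm : (-1 : PowerSeries ℤ_[p]) ^ m * ((g m : ℤ_[p][X]) : PowerSeries ℤ_[p]) = (u m : PowerSeries ℤ_[p]) := by
    rw [hg]
    simp only
    rw [Polynomial.coe_mul, Polynomial.coe_C, map_pow, map_neg, map_one, ← mul_assoc, ← pow_add, ← two_mul, pow_mul]
    norm_num
  rw [hu m, Polynomial.coe_mul]
  have key : (((cyclotomicOmegaPlus p (2 * m + 1)).map (Int.castRingHom ℤ_[p]) : ℤ_[p][X]) : PowerSeries ℤ_[p]) * (u m : PowerSeries ℤ_[p]) -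
      (-1 : PowerSeries ℤ_[p]) ^ m * ((((cyclotomicOmegaPlus p (2 * m + 1)).map (Int.castRingHom ℤ_[p]) : ℤ_[p][X]) : PowerSeries ℤ_[p]) * L) =
      -((-1 : PowerSeries ℤ_[p]) ^ m * ((((cyclotomicOmegaPlus p (2 * m + 1)).map (Int.castRingHom ℤ_[p]) : ℤ_[p][X]) : PowerSeries ℤ_[p]) *
        (L - (g m : PowerSeries ℤ_[p])))) := by
    rw [← hgm]
    ring
  rw [key, hQ, ← mul_assoc (((cyclotomicOmegaPlus p (2 * m + 1)).map (Int.castRingHom ℤ_[p]) : ℤ_[p][X]) : PowerSeries ℤ_[p])]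
  refine dvd_neg.mpr (Dvd.dvd.mul_left (Dvd.dvd.mul_right ?_ _) _)
  have hω : cyclotomicOmegaPlus p (2 * m + 1) * (X * cyclotomicOmegaMinus p (2 * m + 1)) = cyclotomicOmega p (2 * m + 1) := by
    rw [← X_mul_cyclotomicOmegaPlus_mul_cyclotomicOmegaMinus]; ring
  rw [← Polynomial.coe_mul, ← Polynomial.map_mul, hω]

end Abstract

/-! ## §2 Sprung's Coleman pair exists at `a_p = 0`, any prime -/

section Tower

universe u

variable {K : Type u} [Field K] {p : ℕ} [Fact p.Prime] (κ : ZpExtension K p)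
variable {E : Type u} [Field E] [Algebra K E] (ι : AlgebraicClosure K →ₐ[K] AlgebraicClosure E) (W : WeierstrassCurve K)

/-- **Coleman values exist at `a_p = 0`** (any `K`, `p`, `κ`, `ι`): for a family `c` with (L) `c n ∈ E(K_n·K_v)` and the trace relation
`Tr_{n+2/n+1} c_{n+2} = −c_n` (Kobayashi's `Tr`, Def. 1.1), a local lift `g` of the topological generator and EVERY functional `z` on
`E(K_∞·K_v)`: `∃ L♯ L♭, IsColemanPair κ ι W 0 g c z L♯ L♭`. (Sprung's Prop. 3.9/5.3 at `a_p = 0`, with no hypothesis on `p`.)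
[cite: Sprung2012, Prop. 3.9 (p. 1491), Prop. 5.3 and Def. 5.9 (pp. 1493–1495)] [cite: Kobayashi2003, Cor. 8.20–Def. 8.22 (pp. 21–22)] -/
theorem exists_isColemanPair_apZero {g : Field.absoluteGaloisGroup E} (hg : κ.IsTopGenerator (resGalOfEmb ι g))
    (c : ℕ → localPoints W E) (hL : ∀ n, c n ∈ localLayerPointsOfEmb κ ι W n)
    (hTR : ∀ n, localTraceOfEmb κ ι W (n + 1) (n + 2) (c (n + 2)) = -c n)
    (z : Sprung2012.localTowerPointsOfEmb κ ι W →+ ℤ_[p]) :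
    ∃ Ls Lf : IwasawaAlgebra p, Sprung2012.IsColemanPair κ ι W 0 g c z Ls Lf := by
  have hdA : ∀ n, c n ∈ Sprung2012.localTowerPointsOfEmb κ ι W := fun n ↦
    Sprung2012.localLayerPointsOfEmb_le_localTowerPointsOfEmb κ ι W n (hL n)
  have hA : ∀ n j, g ^ j • c n ∈ Sprung2012.localTowerPointsOfEmb κ ι W := fun n j ↦
    Sprung2012.smul_mem_localTowerPointsOfEmb κ ι W _ (hdA n)
  have hfix : ∀ n, g ^ p ^ n • c n = c n := fun n ↦ by
    simpa using Sprung2012.pow_mul_smul_of_mem_localLayerPointsOfEmb κ ι W hg (hL n) 1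
  have htr : ∀ n, ∑ s ∈ range p, g ^ (p ^ (n + 1) * s) • c (n + 2) = -c n := fun n ↦ by
    rw [← Sprung2012.localTraceOfEmb_succ_eq_sum_pow_smul κ ι W hg (n + 1) (hL (n + 2))]
    exact hTR n
  obtain ⟨hper, htr'⟩ := orbitCoeff_periodic_and_trace W (Sprung2012.localTowerPointsOfEmb κ ι W) g c hA hfix htr z
  obtain ⟨Lp, hLp⟩ := exists_plusValue_orbitSum
    (fun n j ↦ Sprung2012.evalOn W (Sprung2012.localTowerPointsOfEmb κ ι W) z (g ^ j • c n)) hper htr'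
  obtain ⟨Lm, hLm⟩ := exists_minusValue_orbitSum
    (fun n j ↦ Sprung2012.evalOn W (Sprung2012.localTowerPointsOfEmb κ ι W) z (g ^ j • c n)) hper htr'
  refine ⟨-Lm, -Lp, fun n ↦ ?_⟩
  obtain ⟨k, rfl | rfl⟩ := Nat.even_or_odd' n
  · -- even level `n = 2k`: `u_{2k} = 0`, `v_{2k} = (−1)^k ω⁻_{2k}`
    rw [(sharpPoly_zero_even_and_odd p k).1, (flatPoly_zero_even_and_odd p k).1, map_zero, zero_mul, zero_add, map_mul, map_pow,
      map_neg, map_one, toIwasawa_apply, toIwasawa_apply, pairingSum_eq_coe_orbitSum]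
    convert hLp k using 1
    ring
  · -- odd level `n = 2k+1`: `u_{2k+1} = (−1)^k ω⁺_{2k+1}`, `v_{2k+1} = 0`
    rw [(sharpPoly_zero_even_and_odd p k).2, (flatPoly_zero_even_and_odd p k).2, map_zero, zero_mul, add_zero, map_mul, map_pow,
      map_neg, map_one, toIwasawa_apply, toIwasawa_apply, pairingSum_eq_coe_orbitSum]
    convert hLm k using 1
    ring

/-! ## §3 The ♭ (= plus) Coleman map is onto `Λ` in the limit -/

/-- **The ♭ value of a functional with a unit at `c_0` is a unit**: level `0` of `IsColemanPair` at `a_p = 0` reads `X ∣ C(z(c_0)) + L♭`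
(`ω_0 = X`, `u_0 = 0`, `v_0 = 1`, `P_{0,c_0}(z) = C(z(c_0))`), so `L♭(0) = −z(c_0)`. [cite: Sprung2012, Def. 7.2 (p. 1500) (`Col^♭_0 = −P⁰_0`)] -/
theorem isUnit_flat_of_isColemanPair_apZero {g : Field.absoluteGaloisGroup E} {c : ℕ → localPoints W E}
    (hc0 : c 0 ∈ Sprung2012.localTowerPointsOfEmb κ ι W) {z : Sprung2012.localTowerPointsOfEmb κ ι W →+ ℤ_[p]}
    {Ls Lf : IwasawaAlgebra p} (h : Sprung2012.IsColemanPair κ ι W 0 g c z Ls Lf) (hz : IsUnit (z ⟨c 0, hc0⟩)) : IsUnit Lf := by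
  have h0 := h 0
  rw [sharpPoly_zero, flatPoly_zero, map_zero, zero_mul, zero_add, map_one, one_mul, Sprung2012.toIwasawa_cyclotomicOmega, pow_zero,
    pow_one, add_sub_cancel_left, Sprung2012.pairingSum_def, pow_zero, Finset.sum_range_one, pow_zero, pow_zero, one_smul, mul_one,
    Sprung2012.evalOn_of_mem W _ z hc0, PowerSeries.X_dvd_iff, map_add, PowerSeries.constantCoeff_C] at h0
  rw [PowerSeries.isUnit_iff_constantCoeff, show PowerSeries.constantCoeff Lf = -z ⟨c 0, hc0⟩ by linear_combination h0]
  exact hz.neg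

/-- **`Col♭` is ONTO `Λ` (all levels at once) at `a_p = 0`, any prime**: for a family `c` with (L), (TR), a local lift `g` of the topological
generator and a functional `z₀` on `E(K_∞·K_v)` with `z₀(c_0) ∈ ℤ_pˣ`, every `a ∈ Λ` is the ♭ Coleman value of some functional:
`∃ z L♯, IsColemanPair κ ι W 0 g c z L♯ a`. (Kobayashi Thm. 6.2 (6.13) / Sprung Prop. 7.3, at `a_p = 0` and without `p ≠ 2`.)
[cite: Kobayashi2003, Thm. 6.2 (6.13) and Prop. 8.23 (pp. 11, 22)] [cite: Sprung2012, Prop. 7.3 (p. 1500) and Def. 5.9] -/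
theorem exists_isColemanPair_flat_eq_of_isUnit {g : Field.absoluteGaloisGroup E} (hg : κ.IsTopGenerator (resGalOfEmb ι g))
    (c : ℕ → localPoints W E) (hL : ∀ n, c n ∈ localLayerPointsOfEmb κ ι W n)
    (hTR : ∀ n, localTraceOfEmb κ ι W (n + 1) (n + 2) (c (n + 2)) = -c n)
    (z₀ : Sprung2012.localTowerPointsOfEmb κ ι W →+ ℤ_[p])
    (hz₀ : IsUnit (z₀ ⟨c 0, Sprung2012.localLayerPointsOfEmb_le_localTowerPointsOfEmb κ ι W 0 (hL 0)⟩)) (a : IwasawaAlgebra p) :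
    ∃ (z : Sprung2012.localTowerPointsOfEmb κ ι W →+ ℤ_[p]) (Ls : IwasawaAlgebra p), Sprung2012.IsColemanPair κ ι W 0 g c z Ls a := by
  obtain ⟨Ls₀, Lf₀, h₀⟩ := exists_isColemanPair_apZero κ ι W hg c hL hTR z₀
  have hunit : IsUnit Lf₀ := isUnit_flat_of_isColemanPair_apZero κ ι W _ h₀ hz₀
  obtain ⟨v, hv⟩ := hunit.exists_left_inv
  obtain ⟨z, hz⟩ := Sprung2012.IsColemanPair.exists_mul hg hL h₀ (a * v)
  refine ⟨z, a * v * Ls₀, ?_⟩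
  rwa [mul_assoc a v Lf₀, hv, mul_one] at hz

end Tower

/-! ## §4 `p = 2`: `Col⁺ = Col♭` is onto `Λ = ℤ₂⟦T⟧` on the cyclotomic `ℤ₂`-tower -/

section Two

open NumberField IsDedekindDomain WeierstrassCurve Literature.NumberTheory.EllipticCurves.Rank1Residual

variable (W : WeierstrassCurve ℚ) [W.IsElliptic] [W.IsGloballyMinimal]

/-- **A functional of the tower that is a unit at `d_0`** (`p = 2`): for `d` with (L) and (ND) `d_0 ∉ 2·E(ℚ_v)` there is an additive
`z₀ : E(ℚ_{2,∞}·ℚ_v) → ℤ₂` with `z₀(d_0) ∈ ℤ₂ˣ` — (ND) propagates to the `2`-torsion-free tower (`E(ℚ_v)` is `2`-saturated there), then Pontryagin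
separation. [cite: Sprung2012, proof of Prop. 7.3 (pp. 1500–1501)] [cite: NeukirchSchmidtWingberg2008, I §1 (1.1.8)] -/
theorem exists_addMonoidHom_isUnit_two (hss : GoodSS W 2) (κ : ZpExtension ℚ 2) (v : HeightOneSpectrum (𝓞 ℚ)) (hv : (2 : 𝓞 ℚ) ∈ v.asIdeal)
    (d : ℕ → localPoints W (v.adicCompletion ℚ))
    (hL : ∀ m, d m ∈ localLayerPointsOfEmb κ (closureEmb (K := ℚ) (v.adicCompletion ℚ)) W m)
    (hND : ∀ b ∈ localLayerPointsOfEmb κ (closureEmb (K := ℚ) (v.adicCompletion ℚ)) W 0, d 0 ≠ 2 • b) :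
    ∃ z₀ : Sprung2012.localTowerPointsOfEmb κ (closureEmb (K := ℚ) (v.adicCompletion ℚ)) W →+ ℤ_[2],
      IsUnit (z₀ ⟨d 0, Sprung2012.localLayerPointsOfEmb_le_localTowerPointsOfEmb κ _ W 0 (hL 0)⟩) := by
  have hdA : ∀ n, d n ∈ Sprung2012.localTowerPointsOfEmb κ (closureEmb (K := ℚ) (v.adicCompletion ℚ)) W := fun n ↦
    Sprung2012.localLayerPointsOfEmb_le_localTowerPointsOfEmb κ _ W n (hL n)
  have hnt : ∀ P ∈ Sprung2012.localTowerPointsOfEmb κ (closureEmb (K := ℚ) (v.adicCompletion ℚ)) W, 2 • P = 0 → P = 0 :=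
    fun P hP h2 ↦ SSFlatEC.eq_zero_of_mem_localTowerPointsOfEmb_of_two_nsmul W hss κ hv _ hP h2
  have hN : ∀ y : Sprung2012.localTowerPointsOfEmb κ (closureEmb (K := ℚ) (v.adicCompletion ℚ)) W, 2 • y = 0 → y = 0 :=
    fun y hy ↦ Subtype.ext (hnt y y.2 (by rw [← AddSubgroupClass.coe_nsmul, hy]; rfl))
  have hn : ∀ y : Sprung2012.localTowerPointsOfEmb κ (closureEmb (K := ℚ) (v.adicCompletion ℚ)) W,
      2 ^ 1 • y ≠ ⟨d 0, hdA 0⟩ := by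
    intro y hy
    have hy' : 2 ^ 1 • (y : localPoints W (v.adicCompletion ℚ)) = d 0 := by
      rw [← AddSubgroupClass.coe_nsmul, hy]
    have hmem : (y : localPoints W (v.adicCompletion ℚ)) ∈ localLayerPointsOfEmb κ (closureEmb (K := ℚ) (v.adicCompletion ℚ)) W 0 :=
      Sprung2012.mem_localLayerPointsOfEmb_of_pow_nsmul_mem κ _ W hnt y.2 (by rw [hy']; exact hL 0)
    exact hND y hmem (by rw [← hy', pow_one])
  obtain ⟨z₀, hz₀⟩ := Literature.Algebra.Module.exists_addMonoidHom_padicInt_not_dvd (p := 2) hN hn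
  refine ⟨z₀, ?_⟩
  rw [PadicInt.isUnit_iff]
  by_contra h
  exact hz₀ (by rw [pow_one]; exact (PadicInt.norm_lt_one_iff_dvd _).mp (lt_of_le_of_ne (PadicInt.norm_le_one _) h))

/-- **`Col⁺ = Col♭ : H¹_Iw(T) → Λ` is ONTO at `p = 2`** (Kobayashi Thm. 6.2 (6.13), Sprung Prop. 7.3, at the prime `2`): for every globally minimal
`W/ℚ` with `GoodSS W 2`, `a₂(W) = 0`, the cyclotomic `κ` and `v ∋ 2`, there are a local lift `g` of the topological generator and a plus Honda
family `d` ((L), (TR), (ND)) such that EVERY `a ∈ Λ = ℤ₂⟦T⟧` is the ♭ Coleman value of a functional on `E(ℚ_{2,∞}·ℚ_v)`: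
`∀ a, ∃ z L♯, IsColemanPair κ (closureEmb ℚ_v) W 0 g d z L♯ a`; and every functional HAS a Coleman pair (`exists_isColemanPair_apZero`).
[cite: Kobayashi2003, Thm. 6.2 (6.13) (p. 11)] [cite: Sprung2012, Prop. 7.3 (p. 1500)] -/
theorem colemanFlat_onto_two (hss : GoodSS W 2) (ha : W.frobeniusTrace 2 = 0) (κ : ZpExtension ℚ 2) (hκ : κ.IsCyclotomic)
    (v : HeightOneSpectrum (𝓞 ℚ)) (hv : (2 : 𝓞 ℚ) ∈ v.asIdeal) :
    ∃ (g : Field.absoluteGaloisGroup (v.adicCompletion ℚ)) (d : ℕ → localPoints W (v.adicCompletion ℚ)),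
      κ.IsTopGenerator (resGalOfEmb (closureEmb (K := ℚ) (v.adicCompletion ℚ)) g) ∧
      (∀ m, d m ∈ localLayerPointsOfEmb κ (closureEmb (K := ℚ) (v.adicCompletion ℚ)) W m) ∧
      (∀ m, localTraceOfEmb κ (closureEmb (K := ℚ) (v.adicCompletion ℚ)) W (m + 1) (m + 2) (d (m + 2)) = -d m) ∧
      (∀ b ∈ localLayerPointsOfEmb κ (closureEmb (K := ℚ) (v.adicCompletion ℚ)) W 0, d 0 ≠ 2 • b) ∧
      ∀ a : IwasawaAlgebra 2,
        ∃ (z : Sprung2012.localTowerPointsOfEmb κ (closureEmb (K := ℚ) (v.adicCompletion ℚ)) W →+ ℤ_[2]) (Ls : IwasawaAlgebra 2),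
          Sprung2012.IsColemanPair κ (closureEmb (K := ℚ) (v.adicCompletion ℚ)) W 0 g d z Ls a := by
  obtain ⟨g, hg⟩ := ZpExtension.IsCyclotomic.exists_isTopGenerator_resGalOfEmb_adicCompletion hκ v hv
  obtain ⟨d, hL, hTR, hND⟩ := exists_plusHonda_nonDiv_two W hss ha κ hκ v hv
  obtain ⟨z₀, hz₀⟩ := exists_addMonoidHom_isUnit_two W hss κ v hv d hL hND
  exact ⟨g, d, hg, hL, hTR, hND, fun a ↦ exists_isColemanPair_flat_eq_of_isUnit κ _ W hg d hL hTR z₀ hz₀ a⟩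

end Two

end Summit.BirchSwinnertonDyer.BirchSwinnertonDyer.Theorems.SignedColemanImage

end
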